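import Mathlib
import HarnessLib
import Summits.HubbardSuperconductivity.HubbardSuperconductivity.Theorems.KLProgrammeKLRegimeTwoLegCurvatureDefs
import Summits.HubbardSuperconductivity.HubbardSuperconductivity.Theorems.KLProgrammeKLRegimeEngineLastRespDefs

/-!
# K3 gen-8-FLOW (stmt 20437, stub (C), located item #20, cure (δ′) «LAST-STEP SWAP», layer F3a): THE FIT — the door's rows in ONE sized currency,
# and their fit to `curveJetBar e_R e_R′ U k (m+1)` with `e_R = (0,1,1,1,1)`, `e_R′ = (1,0,0,0,0)` under ONE polynomial smallness `2⁴³·Z⁵·U ≤ 1`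

Cell gate-hubbard-kl, seat p2 g17.  The response door `lastResponse_jets_door` (`…EngineLastStepResponseDoor`, layer C2) bounds the `θ`-jets of the last-step
response by `Σ_{X=a,b,c} [Σ_{i≤k} C(k,i)·φ_X i·PP_X (k−i) + AA_X k]` with the profile rows `φ_a i = ω₀·2²²(η₀+η)³lⁱ`, `φ_b i = 2³²(η₀+η)²lⁱ`,
`φ_c i = 2²⁸(η₀+η)lⁱ`.  Here (pure arithmetic, `l = 4^m`, `m = n_β`, one n-free constant `Z ≥ 1` above every supplier constant — LAST-THERMAL-SIZING §3):

* §1 `sum_choose_mul_le` — `Σ_{i≤k} C(k,i)·φ i·PP (k−i) ≤ 2ᵏ·Φ·P·lᵏ` when `φ i ≤ Φ·lⁱ`, `PP j ≤ P·lʲ`;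
* §2 **`lastResponse_rows_le`** — with `η₀ + η ≤ 2ZU/l` (tangential dressing parameter: first order in `U`, one scale gain), `ω₀ ≤ Z/l`, `PP_a j ≤ Z·lʲ` (data `1`),
  `PP_b j ≤ Z·U·lʲ` (data `σ_N[K_N]`), `PP_c j ≤ Z·U²·lʲ/l` (the frequency-ODD data: second order AND one scale gain `ω₀`), alias rows `AA_X k ≤ Z·U³·lᵏ/l²`:
  the three rows sum to `≤ 2³⁹·Z⁵·U³·lᵏ/l²` — third order in `U`, i.e. ONE `U` BELOW the registered `U²`-currency at every `k`;
* §3 `four_zpow_sub_two_mul`, **`lastResponse_rows_fit_curveJetBar`** — `2³⁹Z⁵U³lᵏ/l² ≤ curveJetBar e_R e_R′ U k (m+1)` for `k ≤ 4` once `2⁴³·Z⁵·U ≤ 1`,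
  `e_R = fun k => if k = 0 then 0 else 1`, `e_R′ = fun k => if k = 0 then 1 else 0` (so `e_R 0 = 0`: the receiver's pure-`U²` value currency), and
  `lastResponse_rows_fit_of_le_klLastRespU` — the same under the NAMED threshold `U ≤ klLastRespU P R` whenever `2⁴³Z⁵ ≤` its denominator.

Arithmetic only; no definitions; nothing asserts superconductivity.  Refs: BGM 2006 §2.4 (2.36)–(2.42) [cite: BenfattoGiulianiMastropietro2006].
-/

noncomputable section

namespace Summit.HubbardSuperconductivity.HubbardSuperconductivity.Theorems.EngineV8

set_option linter.dupNamespace false -- summit = problem name (single-conjunct summit), D-0017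

open Real Finset
open Summit.HubbardSuperconductivity.HubbardSuperconductivity.Theorems.KLRegimeSplit

/-! ## §1 One Leibniz row in the sized currency -/

/-- `Σ_{i≤k} C(k,i)·φ i·PP (k−i) ≤ 2ᵏ·Φ·P·lᵏ` when `φ i ≤ Φ·lⁱ` (`Φ ≥ 0`) and `0 ≤ PP j ≤ P·lʲ`. -/
theorem sum_choose_mul_le {φ PP : ℕ → ℝ} {Φ P l : ℝ} (k : ℕ) (hl : 0 ≤ l) (hΦ : 0 ≤ Φ)
    (hφ : ∀ i ≤ k, φ i ≤ Φ * l ^ i) (hPP0 : ∀ j ≤ k, 0 ≤ PP j) (hPP : ∀ j ≤ k, PP j ≤ P * l ^ j) :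
    ∑ i ∈ range (k + 1), (k.choose i : ℝ) * φ i * PP (k - i) ≤ 2 ^ k * Φ * P * l ^ k := by
  calc ∑ i ∈ range (k + 1), (k.choose i : ℝ) * φ i * PP (k - i)
      ≤ ∑ i ∈ range (k + 1), (k.choose i : ℝ) * (Φ * P * l ^ k) := by
        refine sum_le_sum fun i hi => ?_
        have hik : i ≤ k := Nat.lt_succ_iff.mp (mem_range.mp hi)
        have h1 : φ i * PP (k - i) ≤ (Φ * l ^ i) * (P * l ^ (k - i)) :=
          mul_le_mul (hφ i hik) (hPP (k - i) (Nat.sub_le k i)) (hPP0 _ (Nat.sub_le k i)) (by positivity)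
        have h2 : (Φ * l ^ i) * (P * l ^ (k - i)) = Φ * P * l ^ k := by
          rw [show l ^ k = l ^ i * l ^ (k - i) by rw [← pow_add, Nat.add_sub_cancel' hik]]; ring
        rw [mul_assoc]
        exact mul_le_mul_of_nonneg_left (h1.trans_eq h2) (Nat.cast_nonneg _)
    _ = 2 ^ k * Φ * P * l ^ k := by
        rw [← sum_mul]
        have h : ∑ i ∈ range (k + 1), (k.choose i : ℝ) = 2 ^ k := by exact_mod_cast Nat.sum_range_choose k
        rw [h]; ring

/-! ## §2 The three rows in the sized currency -/

/-- **THE DOOR'S ROWS, SIZED.**  `0 ≤ U`, `1 ≤ Z`, `1 ≤ l`; `η₀, η ≥ 0`, `η₀ + η ≤ 2ZU/l`; `0 ≤ ω₀ ≤ Z/l`; `0 ≤ PP_a j ≤ Z·lʲ`, `0 ≤ PP_b j ≤ Z·U·lʲ`,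
`0 ≤ PP_c j ≤ Z·U²·lʲ/l` (`j ≤ 4`); `AA_X k ≤ Z·U³·lᵏ/l²` (`k ≤ 4`).  Then for `k ≤ 4`
`[Σ C(k,i)·ω₀2²²(η₀+η)³lⁱ·PP_a (k−i) + AA_a k] + [Σ C(k,i)·2³²(η₀+η)²lⁱ·PP_b (k−i) + AA_b k] + [Σ C(k,i)·2²⁸(η₀+η)lⁱ·PP_c (k−i) + AA_c k] ≤ 2³⁹·Z⁵·U³·lᵏ/l²`. -/
theorem lastResponse_rows_le {U Z l ω₀ η₀ η : ℝ} (hU0 : 0 ≤ U) (hZ : 1 ≤ Z) (hl : 1 ≤ l)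
    (h0 : 0 ≤ η₀) (hη : 0 ≤ η) (hA : η₀ + η ≤ 2 * Z * U / l) (hω0 : 0 ≤ ω₀) (hω : ω₀ ≤ Z / l)
    {PPa PPb PPc AAa AAb AAc : ℕ → ℝ}
    (hPPa0 : ∀ j ≤ 4, 0 ≤ PPa j) (hPPa : ∀ j ≤ 4, PPa j ≤ Z * l ^ j)
    (hPPb0 : ∀ j ≤ 4, 0 ≤ PPb j) (hPPb : ∀ j ≤ 4, PPb j ≤ Z * U * l ^ j)
    (hPPc0 : ∀ j ≤ 4, 0 ≤ PPc j) (hPPc : ∀ j ≤ 4, PPc j ≤ Z * U ^ 2 * l ^ j / l)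
    (hAAa : ∀ k ≤ 4, AAa k ≤ Z * U ^ 3 * l ^ k / l ^ 2) (hAAb : ∀ k ≤ 4, AAb k ≤ Z * U ^ 3 * l ^ k / l ^ 2)
    (hAAc : ∀ k ≤ 4, AAc k ≤ Z * U ^ 3 * l ^ k / l ^ 2) :
    ∀ k ≤ 4,
      ((∑ i ∈ range (k + 1), (k.choose i : ℝ) * (ω₀ * (2 ^ 22 * (η₀ + η) ^ 3 * l ^ i)) * PPa (k - i)) + AAa k) +
      ((∑ i ∈ range (k + 1), (k.choose i : ℝ) * (2 ^ 32 * (η₀ + η) ^ 2 * l ^ i) * PPb (k - i)) + AAb k) +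
      ((∑ i ∈ range (k + 1), (k.choose i : ℝ) * (2 ^ 28 * (η₀ + η) * l ^ i) * PPc (k - i)) + AAc k) ≤
        2 ^ 39 * Z ^ 5 * U ^ 3 * l ^ k / l ^ 2 := by
  intro k hk
  have hl0 : 0 ≤ l := by linarith
  have hlpos : 0 < l := by linarith
  have hA0 : 0 ≤ η₀ + η := by linarith
  have hZ0 : 0 ≤ Z := by linarith
  -- the three Leibniz sums
  have hSa := sum_choose_mul_le (φ := fun i => ω₀ * (2 ^ 22 * (η₀ + η) ^ 3 * l ^ i)) (PP := PPa) (Φ := ω₀ * 2 ^ 22 * (η₀ + η) ^ 3) (P := Z) k hl0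
    (by positivity) (fun i _ => le_of_eq (by ring)) (fun j hj => hPPa0 j (hj.trans hk)) (fun j hj => hPPa j (hj.trans hk))
  have hSb := sum_choose_mul_le (φ := fun i => 2 ^ 32 * (η₀ + η) ^ 2 * l ^ i) (PP := PPb) (Φ := 2 ^ 32 * (η₀ + η) ^ 2) (P := Z * U) k hl0
    (by positivity) (fun i _ => le_of_eq (by ring)) (fun j hj => hPPb0 j (hj.trans hk)) (fun j hj => hPPb j (hj.trans hk))
  have hSc := sum_choose_mul_le (φ := fun i => 2 ^ 28 * (η₀ + η) * l ^ i) (PP := PPc) (Φ := 2 ^ 28 * (η₀ + η)) (P := Z * U ^ 2 / l) k hl0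
    (by positivity) (fun i _ => le_of_eq (by ring)) (fun j hj => hPPc0 j (hj.trans hk))
    (fun j hj => (hPPc j (hj.trans hk)).trans_eq (by ring))
  -- sizes: `(η₀ + η) ≤ 2ZU/l`, `ω₀ ≤ Z/l`, `2ᵏ ≤ 16`, `1/l⁴, 1/l³ ≤ 1/l²`
  have h2k : (2 : ℝ) ^ k ≤ 16 := by
    have : (2 : ℝ) ^ k ≤ 2 ^ 4 := pow_le_pow_right₀ (by norm_num) hk
    linarith [show (2 : ℝ) ^ 4 = 16 by norm_num]
  have hlk0 : 0 ≤ l ^ k := pow_nonneg hl0 k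
  have hAl : (η₀ + η) * l ≤ 2 * Z * U := by rwa [← le_div_iff₀ hlpos]
  have hωl : ω₀ * l ≤ Z := by rwa [← le_div_iff₀ hlpos]
  have hU3 : 0 ≤ U ^ 3 := by positivity
  -- row a: `2ᵏ·(ω₀2²²(η₀ + η)³)·Z·lᵏ ≤ 2²⁹ Z⁵ U³ lᵏ/l²` (uses `((η₀ + η) l)³ ≤ 8Z³U³`, `ω₀ l ≤ Z`, `l ≥ 1`)
  have hRa : 2 ^ k * (ω₀ * 2 ^ 22 * (η₀ + η) ^ 3) * Z * l ^ k ≤ 2 ^ 29 * Z ^ 5 * U ^ 3 * l ^ k / l ^ 2 := by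
    rw [le_div_iff₀ (by positivity)]
    have h3 : ((η₀ + η) * l) ^ 3 ≤ (2 * Z * U) ^ 3 := by gcongr
    have h4 : ω₀ * (η₀ + η) ^ 3 * l ^ 4 ≤ 8 * Z ^ 4 * U ^ 3 := by
      have : ω₀ * (η₀ + η) ^ 3 * l ^ 4 = (ω₀ * l) * ((η₀ + η) * l) ^ 3 := by ring
      rw [this]
      calc (ω₀ * l) * ((η₀ + η) * l) ^ 3 ≤ Z * (2 * Z * U) ^ 3 :=
            mul_le_mul hωl h3 (pow_nonneg (mul_nonneg hA0 hl0) 3) hZ0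
        _ = 8 * Z ^ 4 * U ^ 3 := by ring
    have h5 : ω₀ * (η₀ + η) ^ 3 * l ^ 2 ≤ 8 * Z ^ 4 * U ^ 3 := by
      have : ω₀ * (η₀ + η) ^ 3 * l ^ 2 ≤ ω₀ * (η₀ + η) ^ 3 * l ^ 4 := by
        have : l ^ 2 ≤ l ^ 4 := pow_le_pow_right₀ hl (by norm_num)
        have : 0 ≤ ω₀ * (η₀ + η) ^ 3 := by positivity
        nlinarith
      linarith
    calc 2 ^ k * (ω₀ * 2 ^ 22 * (η₀ + η) ^ 3) * Z * l ^ k * l ^ 2 = (2 ^ k) * (2 ^ 22 * Z * l ^ k) * (ω₀ * (η₀ + η) ^ 3 * l ^ 2) := by ring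
      _ ≤ 16 * (2 ^ 22 * Z * l ^ k) * (8 * Z ^ 4 * U ^ 3) := by
          apply mul_le_mul (mul_le_mul_of_nonneg_right h2k (by positivity)) h5 (by positivity) (by positivity)
      _ = 2 ^ 29 * Z ^ 5 * U ^ 3 * l ^ k := by ring
  -- row b: `2ᵏ·(2³²(η₀ + η)²)·(ZU)·lᵏ ≤ 2³⁸ Z³ U³ lᵏ/l²`
  have hRb : 2 ^ k * (2 ^ 32 * (η₀ + η) ^ 2) * (Z * U) * l ^ k ≤ 2 ^ 38 * Z ^ 3 * U ^ 3 * l ^ k / l ^ 2 := by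
    rw [le_div_iff₀ (by positivity)]
    have h3 : ((η₀ + η) * l) ^ 2 ≤ (2 * Z * U) ^ 2 := by gcongr
    calc 2 ^ k * (2 ^ 32 * (η₀ + η) ^ 2) * (Z * U) * l ^ k * l ^ 2 = (2 ^ k) * (2 ^ 32 * Z * U * l ^ k) * ((η₀ + η) * l) ^ 2 := by ring
      _ ≤ 16 * (2 ^ 32 * Z * U * l ^ k) * (2 * Z * U) ^ 2 := by
          apply mul_le_mul (mul_le_mul_of_nonneg_right h2k (by positivity)) h3 (by positivity) (by positivity)
      _ = 2 ^ 38 * Z ^ 3 * U ^ 3 * l ^ k := by ring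
  -- row c: `2ᵏ·(2²⁸(η₀ + η))·(ZU²/l)·lᵏ ≤ 2³³ Z² U³ lᵏ/l²`
  have hRc : 2 ^ k * (2 ^ 28 * (η₀ + η)) * (Z * U ^ 2 / l) * l ^ k ≤ 2 ^ 33 * Z ^ 2 * U ^ 3 * l ^ k / l ^ 2 := by
    rw [le_div_iff₀ (by positivity)]
    have : 2 ^ k * (2 ^ 28 * (η₀ + η)) * (Z * U ^ 2 / l) * l ^ k * l ^ 2 = (2 ^ k) * (2 ^ 28 * Z * U ^ 2 * l ^ k) * ((η₀ + η) * l) := by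
      field_simp
    rw [this]
    calc (2 ^ k) * (2 ^ 28 * Z * U ^ 2 * l ^ k) * ((η₀ + η) * l) ≤ 16 * (2 ^ 28 * Z * U ^ 2 * l ^ k) * (2 * Z * U) := by
          apply mul_le_mul (mul_le_mul_of_nonneg_right h2k (by positivity)) hAl (mul_nonneg hA0 hl0) (by positivity)
      _ = 2 ^ 33 * Z ^ 2 * U ^ 3 * l ^ k := by ring
  -- alias rows and the total
  have hAk := hAAa k hk
  have hBk := hAAb k hk
  have hCk := hAAc k hk
  have hZ5 : Z ^ 3 ≤ Z ^ 5 := pow_le_pow_right₀ hZ (by norm_num)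
  have hZ2 : Z ^ 2 ≤ Z ^ 5 := pow_le_pow_right₀ hZ (by norm_num)
  have hZ1 : Z ≤ Z ^ 5 := by simpa using pow_le_pow_right₀ hZ (show 1 ≤ 5 by norm_num)
  have hq : 0 ≤ U ^ 3 * l ^ k / l ^ 2 := by positivity
  have e1 : 2 ^ 29 * Z ^ 5 * U ^ 3 * l ^ k / l ^ 2 + 2 ^ 38 * Z ^ 3 * U ^ 3 * l ^ k / l ^ 2 + 2 ^ 33 * Z ^ 2 * U ^ 3 * l ^ k / l ^ 2 +
      3 * (Z * U ^ 3 * l ^ k / l ^ 2) ≤ 2 ^ 39 * Z ^ 5 * U ^ 3 * l ^ k / l ^ 2 := by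
    have : 2 ^ 29 * Z ^ 5 * U ^ 3 * l ^ k / l ^ 2 + 2 ^ 38 * Z ^ 3 * U ^ 3 * l ^ k / l ^ 2 + 2 ^ 33 * Z ^ 2 * U ^ 3 * l ^ k / l ^ 2 +
        3 * (Z * U ^ 3 * l ^ k / l ^ 2) = (2 ^ 29 * Z ^ 5 + 2 ^ 38 * Z ^ 3 + 2 ^ 33 * Z ^ 2 + 3 * Z) * (U ^ 3 * l ^ k / l ^ 2) := by ring
    rw [this, show (2 : ℝ) ^ 39 * Z ^ 5 * U ^ 3 * l ^ k / l ^ 2 = (2 ^ 39 * Z ^ 5) * (U ^ 3 * l ^ k / l ^ 2) by ring]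
    apply mul_le_mul_of_nonneg_right _ hq
    nlinarith
  have t1 := add_le_add (add_le_add (add_le_add (hSa.trans hRa) hAk) (add_le_add (hSb.trans hRb) hBk)) (add_le_add (hSc.trans hRc) hCk)
  linarith [t1, e1]

/-! ## §3 The fit to `curveJetBar` -/

/-- `4^{(k−2)n} = (4ⁿ)ᵏ/(4ⁿ)²`. -/
theorem four_zpow_sub_two_mul (k n : ℕ) : (4 : ℝ) ^ (((k : ℤ) - 2) * n) = ((4 : ℝ) ^ n) ^ k / ((4 : ℝ) ^ n) ^ 2 := by
  have h4 : ((4 : ℝ) ^ n) ≠ 0 := by positivity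
  rw [mul_comm, zpow_mul, zpow_natCast, zpow_sub₀ h4, zpow_natCast, zpow_ofNat]

/-- **THE FIT.**  With `e_R = fun k => if k = 0 then 0 else 1`, `e_R′ = fun k => if k = 0 then 1 else 0`, `l = 4^m`, `0 < U`, `1 ≤ Z`, `2⁴³·Z⁵·U ≤ 1`:
`2³⁹·Z⁵·U³·lᵏ/l² ≤ curveJetBar e_R e_R′ U k (m+1)` for `k ≤ 4` (value: `U²·|U|·4^{−2(m+1)}`-currency with `e_R 0 = 0`; orders `1…4`: `U²·4^{(k−2)(m+1)}`). -/
theorem lastResponse_rows_fit_curveJetBar {U Z : ℝ} (m : ℕ) (hU : 0 < U) (hZ : 1 ≤ Z) (hUZ : 2 ^ 43 * Z ^ 5 * U ≤ 1) :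
    ∀ k ≤ 4, 2 ^ 39 * Z ^ 5 * U ^ 3 * ((4 : ℝ) ^ m) ^ k / ((4 : ℝ) ^ m) ^ 2 ≤
      curveJetBar (fun k => if k = 0 then 0 else 1) (fun k => if k = 0 then 1 else 0) U k (m + 1) := by
  intro k hk
  have hZ0 : 0 ≤ Z := by linarith
  have hq0 : (0 : ℝ) < ((4 : ℝ) ^ m) ^ k / (((4 : ℝ) ^ m) ^ 2 * 16) := by positivity
  -- the scale-free core: `2⁴³Z⁵U³ ≤ (e k + e' k·|U|)·uPow k U·4ᵏ`
  have hU2 : 2 ^ 43 * Z ^ 5 * U * U ^ 2 ≤ 1 * U ^ 2 := mul_le_mul_of_nonneg_right hUZ (by positivity)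
  have key : 2 ^ 39 * Z ^ 5 * U ^ 3 * 16 ≤
      (((fun k : ℕ => if k = 0 then (0 : ℝ) else 1) k + (fun k : ℕ => if k = 0 then (1 : ℝ) else 0) k * |U|) * uPow k U * 4 ^ k) := by
    rcases Nat.eq_zero_or_pos k with rfl | hkpos
    · simp only [uPow_zero, abs_of_pos hU, pow_zero]
      rw [if_pos trivial, if_pos trivial]
      nlinarith [hU2]
    · have hk0 : k ≠ 0 := Nat.pos_iff_ne_zero.mp hkpos
      simp only [if_neg hk0, uPow, zero_mul, add_zero, one_mul]
      have h4k : (4 : ℝ) ≤ 4 ^ k := by simpa using pow_le_pow_right₀ (by norm_num : (1 : ℝ) ≤ 4) hkpos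
      nlinarith [hU2, mul_le_mul_of_nonneg_left h4k (pow_pos hU 2).le]
  have eqL : 2 ^ 39 * Z ^ 5 * U ^ 3 * ((4 : ℝ) ^ m) ^ k / ((4 : ℝ) ^ m) ^ 2 =
      (2 ^ 39 * Z ^ 5 * U ^ 3 * 16) * (((4 : ℝ) ^ m) ^ k / (((4 : ℝ) ^ m) ^ 2 * 16)) := by
    field_simp
  have eqR : curveJetBar (fun k => if k = 0 then 0 else 1) (fun k => if k = 0 then 1 else 0) U k (m + 1) =
      (((fun k : ℕ => if k = 0 then (0 : ℝ) else 1) k + (fun k : ℕ => if k = 0 then (1 : ℝ) else 0) k * |U|) * uPow k U * 4 ^ k) *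
        (((4 : ℝ) ^ m) ^ k / (((4 : ℝ) ^ m) ^ 2 * 16)) := by
    rw [curveJetBar_apply, four_zpow_sub_two_mul, pow_succ, mul_pow, mul_pow]
    field_simp
    ring
  rw [eqL, eqR]
  exact mul_le_mul_of_nonneg_right key hq0.le

/-- The value row constant vanishes: `e_R 0 = 0` (the receiver's `heR0`). -/
theorem lastResponse_eR_zero : (fun k : ℕ => if k = 0 then (0 : ℝ) else 1) 0 = 0 := if_pos rfl

/-- **The fit under the NAMED threshold**: if `2⁴³·Z⁵ ≤ 2²⁵⁶·klEngPsq⁴·klEngRsq⁸·(klE3Acum²+1)²` (the denominator of `klLastRespU P R`) and `0 < U ≤ klLastRespU P R`,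
the rows fit. -/
theorem lastResponse_rows_fit_of_le_klLastRespU (P : SplitConsts) (R : RenConsts) {U Z : ℝ} (m : ℕ) (hU : 0 < U) (hZ : 1 ≤ Z)
    (hZden : 2 ^ 43 * Z ^ 5 ≤ (2 : ℝ) ^ 256 * klEngPsq P ^ 4 * klEngRsq R ^ 8 * (klE3Acum R ^ 2 + 1) ^ 2) (hUR : U ≤ klLastRespU P R) :
    ∀ k ≤ 4, 2 ^ 39 * Z ^ 5 * U ^ 3 * ((4 : ℝ) ^ m) ^ k / ((4 : ℝ) ^ m) ^ 2 ≤
      curveJetBar (fun k => if k = 0 then 0 else 1) (fun k => if k = 0 then 1 else 0) U k (m + 1) :=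
  lastResponse_rows_fit_curveJetBar m hU hZ (mul_le_one_of_le_klLastRespU hZden hU.le hUR)

end Summit.HubbardSuperconductivity.HubbardSuperconductivity.Theorems.EngineV8

end
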